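import Summits.HodgeConjecture.CorCM.Census.QuaternionColumnBlocks

/-!
# The quaternion column, VIII-b: the near blocks of `T₀ = barc 0 0` are pairwise distinct

COR-CM (cell `pub-hodgecm2`), count-neutral kernel combinatorics by the binder seat b09 (gen 39; lane QUATERNION COLUMN), part VIII-b, on part
VIII-a (`Census/QuaternionColumnBlocks.lean`: the halves `aPart`/`xPart`, their transport, the trivial-transporter lemmas `eq_one_of_xPart/aPart`,
the halves of `U_i, V_j, C_i, C'_j` and their non-arc-ness) used BY NAME.  Theorems only: no definition, no `decide`, no certificate, no named
fact, no `sorry`.  HONEST FRAMING: `HC_CM` is NOT proved, here or anywhere in the tree; nothing here is a period or a headline.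

**THE DISTINCTNESS THEOREMS** (`1 ≤ i, i' ≤ n−2`, `1 ≤ j ≤ n−2` resp. `≤ n−3` for `C'`, `n ≥ 4`): `blk U_i = blk U_{i'} → i = i'` (`blk_U_inj`),
`blk_V_inj`, `blk_C_inj`, `blk_C'_inj`; `blk U_i ≠ blk V_j` (`blk_U_ne_V`), `blk C_i ≠ blk C'_j` (`blk_C_ne_C'`); no one-arc near type lies in a
biarc block (`blk_ne_barc_of_aPart/xPart`); `barc` is injective and the biarc blocks `blk (barc s 0)`, `s < n`, are distinct
(`blk_barc_natCast_inj`).  These are the pivot-distinctness inputs of the fibre-independence of the explicit family `qfam` (part VIII-c).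

## References
* [Pohlmann1968] H. Pohlmann, Algebraic cycles on abelian varieties of complex multiplication type, Ann. of Math. 88 (1968), Thm 1.
-/

namespace Summit.HodgeConjecture.CorCM.Census.QuaternionColumn

open Finset QuaternionGroup
open Summit.HodgeConjecture.CorCM.Prior.AllgGroup.RfwfAllgGroup
open Summit.HodgeConjecture.CorCM.Census.BlockParity
open Summit.HodgeConjecture.CorCM.Census.BaseBlock
open Summit.HodgeConjecture.CorCM.Census.TwistGeneration

noncomputable section

variable {n : ℕ} [NeZero n]

/-! ### The distinctness theorems -/

/-- **The rotation single-flip blocks are distinct**: `blk U_i = blk U_{i'} → i = i'` (`1 ≤ i, i' ≤ n−2`). [folklore] -/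
theorem blk_U_inj {i i' : ℕ} (hi : 1 ≤ i) (hi2 : i + 2 ≤ n) (hi' : 1 ≤ i') (hi'2 : i' + 2 ≤ n)
    (h : blk (c n) (oflipCM (c n) c_mul_c (a (i : ZMod (2 * n))) (barc (0 : ZMod (2 * n)) 0)) =
      blk (c n) (oflipCM (c n) c_mul_c (a (i' : ZMod (2 * n))) (barc (0 : ZMod (2 * n)) 0))) : i = i' := by
  obtain ⟨Q, hQ⟩ := exists_rt_eq_of_blk_eq (c n) h
  have hQ1 : Q = 1 := eq_one_of_xPart (parts_U _).1 (aPart_U_ne_arcZ i hi hi2) (by rw [hQ, (parts_U _).1])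
  rw [hQ1, rt_one] at hQ
  by_contra hne
  have hm : ((i' : ℕ) : ZMod (2 * n)) ∈ aPart (oflipCM (c n) c_mul_c (a (i : ZMod (2 * n))) (barc (0 : ZMod (2 * n)) 0)) := by
    rw [natCast_mem_aPart_U rfl (by omega) (by omega)]; omega
  rw [hQ, natCast_mem_aPart_U rfl (by omega) (by omega)] at hm
  omega

/-- **The reflection single-flip blocks are distinct.** [folklore] -/
theorem blk_V_inj {j j' : ℕ} (hj : 1 ≤ j) (hj2 : j + 2 ≤ n) (hj' : 1 ≤ j') (hj'2 : j' + 2 ≤ n)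
    (h : blk (c n) (oflipCM (c n) c_mul_c (xa (j : ZMod (2 * n))) (barc (0 : ZMod (2 * n)) 0)) =
      blk (c n) (oflipCM (c n) c_mul_c (xa (j' : ZMod (2 * n))) (barc (0 : ZMod (2 * n)) 0))) : j = j' := by
  obtain ⟨Q, hQ⟩ := exists_rt_eq_of_blk_eq (c n) h
  have hQ1 : Q = 1 := eq_one_of_aPart (parts_V _).1 (xPart_V_ne_arcZ j hj hj2) (by rw [hQ, (parts_V _).1])
  rw [hQ1, rt_one] at hQ
  by_contra hne
  have hm : ((j' : ℕ) : ZMod (2 * n)) ∈ xPart (oflipCM (c n) c_mul_c (xa (j : ZMod (2 * n))) (barc (0 : ZMod (2 * n)) 0)) := by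
    rw [natCast_mem_xPart_V rfl (by omega) (by omega)]; omega
  rw [hQ, natCast_mem_xPart_V rfl (by omega) (by omega)] at hm
  omega

/-- **The coincidence blocks of the rotation chain are distinct.** [folklore] -/
theorem blk_C_inj {i i' : ℕ} (hi : 1 ≤ i) (hi2 : i + 2 ≤ n) (hi' : 1 ≤ i') (hi'2 : i' + 2 ≤ n)
    (h : blk (c n) (oflipCM (c n) c_mul_c (a 0) (oflipCM (c n) c_mul_c (a ((i : ZMod (2 * n)) + 1)) (barc (0 : ZMod (2 * n)) 0))) =
      blk (c n) (oflipCM (c n) c_mul_c (a 0) (oflipCM (c n) c_mul_c (a ((i' : ZMod (2 * n)) + 1)) (barc (0 : ZMod (2 * n)) 0)))) : i = i' := by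
  obtain ⟨Q, hQ⟩ := exists_rt_eq_of_blk_eq (c n) h
  have hQ1 : Q = 1 := eq_one_of_xPart (parts_C _).1 (aPart_C_ne_arcZ i hi hi2) (by rw [hQ, (parts_C _).1])
  rw [hQ1, rt_one] at hQ
  by_contra hne
  have hm : (((i' + 1 : ℕ) : ℕ) : ZMod (2 * n)) ∈
      aPart (oflipCM (c n) c_mul_c (a 0) (oflipCM (c n) c_mul_c (a ((i : ZMod (2 * n)) + 1)) (barc (0 : ZMod (2 * n)) 0))) := by
    rw [natCast_mem_aPart_C rfl (by omega) (by omega)]; omega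
  rw [hQ, natCast_mem_aPart_C rfl (by omega) (by omega)] at hm
  omega

/-- **The coincidence blocks of the reflection chain are distinct.** [folklore] -/
theorem blk_C'_inj {j j' : ℕ} (hj : 1 ≤ j) (hj3 : j + 3 ≤ n) (hj' : 1 ≤ j') (hj'3 : j' + 3 ≤ n)
    (h : blk (c n) (oflipCM (c n) c_mul_c (a 0) (oflipCM (c n) c_mul_c (xa ((j : ZMod (2 * n)) + 1)) (barc (0 : ZMod (2 * n)) 0))) =
      blk (c n) (oflipCM (c n) c_mul_c (a 0) (oflipCM (c n) c_mul_c (xa ((j' : ZMod (2 * n)) + 1)) (barc (0 : ZMod (2 * n)) 0)))) : j = j' := by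
  obtain ⟨Q, hQ⟩ := exists_rt_eq_of_blk_eq (c n) h
  -- transport `aPart = arcZ 1` to the standard position by the rotation `a 1`
  have hQ1 : Q = 1 := by
    have h1 : aPart (rt (c n) (a 1) (oflipCM (c n) c_mul_c (a 0) (oflipCM (c n) c_mul_c (xa ((j : ZMod (2 * n)) + 1)) (barc 0 0)))) = arcZ 0 := by
      rw [(parts_rt_a 1 _).1, aPart_C', image_sub_arcZ, sub_self]
    have h2 : ∀ p, xPart (rt (c n) (a 1) (oflipCM (c n) c_mul_c (a 0) (oflipCM (c n) c_mul_c (xa ((j : ZMod (2 * n)) + 1)) (barc 0 0)))) ≠ arcZ p := by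
      intro p hp
      rw [(parts_rt_a 1 _).2] at hp
      exact xPart_C'_ne_arcZ j hj hj3 _ (isArc_of_image_sub hp)
    have h3 : aPart (rt (c n) (a 1 * Q * (a 1)⁻¹) (rt (c n) (a 1) (oflipCM (c n) c_mul_c (a 0)
        (oflipCM (c n) c_mul_c (xa ((j : ZMod (2 * n)) + 1)) (barc 0 0))))) = arcZ 0 := by
      rw [← rt_mul, inv_mul_cancel_right, rt_mul, hQ, (parts_rt_a 1 _).1, aPart_C', image_sub_arcZ, sub_self]
    have h4 := eq_one_of_aPart h1 h2 h3
    have : Q = (a 1)⁻¹ * (a 1 * Q * (a 1)⁻¹) * a 1 := by group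
    rw [this, h4]; group
  rw [hQ1, rt_one] at hQ
  by_contra hne
  have hm : (((j' + 1 : ℕ) : ℕ) : ZMod (2 * n)) ∈
      xPart (oflipCM (c n) c_mul_c (a 0) (oflipCM (c n) c_mul_c (xa ((j : ZMod (2 * n)) + 1)) (barc (0 : ZMod (2 * n)) 0))) := by
    rw [natCast_mem_xPart_C' rfl (by omega) (by omega)]; omega
  rw [hQ, natCast_mem_xPart_C' rfl (by omega) (by omega)] at hm
  omega

/-- **No single-flip or coincidence block is a biarc block**: a block containing a biarc consists of biarcs (both halves arcs). [folklore] -/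
theorem blk_ne_barc_of_aPart {Ψ : CMF (QuaternionGroup n) (c n)} (ha : ∀ p, aPart Ψ ≠ arcZ p) (p q : ZMod (2 * n)) :
    blk (c n) Ψ ≠ blk (c n) (barc p q) := by
  intro h
  obtain ⟨Q, hQ⟩ := exists_rt_eq_of_blk_eq (c n) h.symm
  cases Q with
  | a k => rw [rt_a_barc] at hQ; exact ha _ (by rw [← hQ, (parts_barc _ _).1])
  | xa k => rw [rt_xa_barc] at hQ; exact ha _ (by rw [← hQ, (parts_barc _ _).1])

/-- Same with the reflection half. [folklore] -/
theorem blk_ne_barc_of_xPart {Ψ : CMF (QuaternionGroup n) (c n)} (hx : ∀ p, xPart Ψ ≠ arcZ p) (p q : ZMod (2 * n)) :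
    blk (c n) Ψ ≠ blk (c n) (barc p q) := by
  intro h
  obtain ⟨Q, hQ⟩ := exists_rt_eq_of_blk_eq (c n) h.symm
  cases Q with
  | a k => rw [rt_a_barc] at hQ; exact hx _ (by rw [← hQ, (parts_barc _ _).2])
  | xa k => rw [rt_xa_barc] at hQ; exact hx _ (by rw [← hQ, (parts_barc _ _).2])

/-- Three candidates avoid two values: some `v ∈ {1,2,3}` differs from `x` and `y`. [folklore] -/
theorem exists_avoid_two (x y : ℕ) : ∃ v : ℕ, 1 ≤ v ∧ v ≤ 3 ∧ v ≠ x ∧ v ≠ y := by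
  by_cases h1 : 1 ≠ x ∧ 1 ≠ y
  · exact ⟨1, le_rfl, by omega, h1.1, h1.2⟩
  by_cases h2 : 2 ≠ x ∧ 2 ≠ y
  · exact ⟨2, by omega, by omega, h2.1, h2.2⟩
  exact ⟨3, by omega, le_rfl, by omega, by omega⟩

omit [NeZero n] in
/-- `−(v : ℤ/2n) = (2n − v : ℕ)` for `v ≤ 2n`, and `−1 − v = (2n − 1 − v : ℕ)` for `v < 2n`. [folklore] -/
theorem neg_natCast_eq {v : ℕ} (hv : v ≤ 2 * n) :
    -((v : ℕ) : ZMod (2 * n)) = ((2 * n - v : ℕ) : ℕ) ∧ (v < 2 * n → (-1 : ZMod (2 * n)) - (v : ℕ) = ((2 * n - 1 - v : ℕ) : ℕ)) := by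
  have h2n : ((2 * n : ℕ) : ZMod (2 * n)) = 0 := ZMod.natCast_self _
  refine ⟨?_, fun hv' => ?_⟩
  · rw [Nat.cast_sub hv, h2n, zero_sub]
  · rw [Nat.cast_sub (by omega), Nat.cast_sub (by omega), h2n, zero_sub, Nat.cast_one]

/-- **A rotation single-flip block is never a reflection single-flip block** (`1 ≤ i, j ≤ n−2`, `n ≥ 4`). [folklore] -/
theorem blk_U_ne_V (h4 : 4 ≤ n) {i j : ℕ} (hi : 1 ≤ i) (hi2 : i + 2 ≤ n) (hj : 1 ≤ j) (hj2 : j + 2 ≤ n) :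
    blk (c n) (oflipCM (c n) c_mul_c (a (i : ZMod (2 * n))) (barc (0 : ZMod (2 * n)) 0)) ≠
      blk (c n) (oflipCM (c n) c_mul_c (xa (j : ZMod (2 * n))) (barc (0 : ZMod (2 * n)) 0)) := by
  intro h
  obtain ⟨Q, hQ⟩ := exists_rt_eq_of_blk_eq (c n) h
  cases Q with
  | a k =>
    have ha := congrArg aPart hQ
    rw [(parts_rt_a k _).1, (parts_V _).1] at ha
    exact aPart_U_ne_arcZ i hi hi2 _ (isArc_of_image_sub ha)
  | xa k =>
    have ha := congrArg aPart hQ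
    rw [(parts_rt_xa k _).1, (parts_U _).1, image_reflect_arcZ, (parts_V _).1, sub_zero] at ha
    have hk : k = -1 - (n : ZMod (2 * n)) := by have := arcZ_inj ha; linear_combination this
    have hx := congrArg xPart hQ
    rw [(parts_rt_xa k _).2, hk, show (n : ZMod (2 * n)) + (-1 - (n : ZMod (2 * n))) = -1 by ring] at hx
    obtain ⟨v, hv1, hv3, hvj, hvi⟩ := exists_avoid_two j (n - 1 - i)
    have hmem : ((v : ℕ) : ZMod (2 * n)) ∈ xPart (oflipCM (c n) c_mul_c (xa (j : ZMod (2 * n))) (barc (0 : ZMod (2 * n)) 0)) := by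
      rw [natCast_mem_xPart_V rfl (by omega) (by omega)]; omega
    rw [← hx, mem_image] at hmem
    obtain ⟨w, hw, hwv⟩ := hmem
    have hw' : w = -1 - (v : ℕ) := by rw [← hwv]; ring
    rw [hw', (neg_natCast_eq (n := n) (v := v) (by omega)).2 (by omega), natCast_mem_aPart_U rfl (by omega) (by omega)] at hw
    omega

/-- **A rotation coincidence block is never a reflection coincidence block** (`1 ≤ i ≤ n−2`, `1 ≤ j ≤ n−3`, `n ≥ 4`). [folklore] -/
theorem blk_C_ne_C' (h4 : 4 ≤ n) {i j : ℕ} (hi : 1 ≤ i) (hi2 : i + 2 ≤ n) (hj : 1 ≤ j) (hj3 : j + 3 ≤ n) :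
    blk (c n) (oflipCM (c n) c_mul_c (a 0) (oflipCM (c n) c_mul_c (a ((i : ZMod (2 * n)) + 1)) (barc (0 : ZMod (2 * n)) 0))) ≠
      blk (c n) (oflipCM (c n) c_mul_c (a 0) (oflipCM (c n) c_mul_c (xa ((j : ZMod (2 * n)) + 1)) (barc (0 : ZMod (2 * n)) 0))) := by
  intro h
  obtain ⟨Q, hQ⟩ := exists_rt_eq_of_blk_eq (c n) h
  cases Q with
  | a k =>
    have ha := congrArg aPart hQ
    rw [(parts_rt_a k _).1, aPart_C'] at ha
    exact aPart_C_ne_arcZ i hi hi2 _ (isArc_of_image_sub ha)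
  | xa k =>
    have ha := congrArg aPart hQ
    rw [(parts_rt_xa k _).1, (parts_C _).1, image_reflect_arcZ, aPart_C', sub_zero] at ha
    have hk : k = -(n : ZMod (2 * n)) := by have := arcZ_inj ha; linear_combination this
    have hx := congrArg xPart hQ
    rw [(parts_rt_xa k _).2, hk, add_neg_cancel] at hx
    obtain ⟨v, hv1, hv3, hvj, hvi⟩ := exists_avoid_two (j + 1) (n - 1 - i)
    have hmem : ((v : ℕ) : ZMod (2 * n)) ∈ xPart (oflipCM (c n) c_mul_c (a 0) (oflipCM (c n) c_mul_c (xa ((j : ZMod (2 * n)) + 1)) (barc 0 0))) := by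
      rw [natCast_mem_xPart_C' rfl (by omega) (by omega)]; omega
    rw [← hx, mem_image] at hmem
    obtain ⟨w, hw, hwv⟩ := hmem
    have hw' : w = -((v : ℕ) : ZMod (2 * n)) := by rw [← hwv]; ring
    rw [hw', (neg_natCast_eq (n := n) (v := v) (by omega)).1, natCast_mem_aPart_C rfl (by omega) (by omega)] at hw
    omega

/-- **`barc` is injective.** [folklore] -/
theorem barc_inj {p q p' q' : ZMod (2 * n)} (h : barc p q = barc p' q') : p = p' ∧ q = q' := by
  have ha := congrArg aPart h
  have hx := congrArg xPart h
  rw [(parts_barc _ _).1, (parts_barc _ _).1] at ha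
  rw [(parts_barc _ _).2, (parts_barc _ _).2] at hx
  exact ⟨arcZ_inj ha, arcZ_inj hx⟩

/-- **The biarc blocks `blk (barc s 0)`, `s < n`, are distinct.** [folklore] -/
theorem blk_barc_natCast_inj {s s' : ℕ} (hs : s < n) (hs' : s' < n)
    (h : blk (c n) (barc ((s : ℕ) : ZMod (2 * n)) 0) = blk (c n) (barc ((s' : ℕ) : ZMod (2 * n)) 0)) : s = s' := by
  obtain ⟨Q, hQ⟩ := exists_rt_eq_of_blk_eq (c n) h
  cases Q with
  | a k =>
    rw [rt_a_barc] at hQ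
    obtain ⟨h1, h2⟩ := barc_inj hQ
    have hk : k = 0 := by have : (0 : ZMod (2 * n)) - k = 0 := h2; linear_combination -this
    rw [hk, sub_zero] at h1
    exact (natCast_eq_natCast_iff' (by omega) (by omega)).mp h1
  | xa k =>
    rw [rt_xa_barc] at hQ
    obtain ⟨h1, h2⟩ := barc_inj hQ
    have hk : k = (s : ℕ) - 1 := by linear_combination h2
    rw [hk] at h1
    have h3 : ((s : ℕ) : ZMod (2 * n)) + (n : ZMod (2 * n)) = (s' : ℕ) := by rw [← h1]; ring
    rw [← Nat.cast_add, natCast_eq_natCast_iff' (by omega) (by omega)] at h3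
    omega

end

end Summit.HodgeConjecture.CorCM.Census.QuaternionColumn
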